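import Summits.Langlands.Langlands.Theorems.NonParallelVoidTwistedInductionParallelSymmetriseDefs
import Summits.Langlands.Langlands.Theorems.NonParallelVoidTwistedInductionParallelSymmetriseDefsV7
import Literature.NumberTheory.Automorphic.Qian2022HLTTConj
import Literature.NumberTheory.Automorphic.ReciprocityGLnRestrictionProofs
import Literature.NumberTheory.Automorphic.BaseChangeOfAutomorphicInduction
import Literature.NumberTheory.Automorphic.QuadraticCharacterTwist
import Literature.NumberTheory.Automorphic.AutomorphicInductionOfSelfTwist
import Literature.NumberTheory.GaloisRepresentations.InducedSelfTwist
import Literature.NumberTheory.GaloisRepresentations.InducedRestrictCompositumBlocks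
import Literature.NumberTheory.GaloisRepresentations.ToLocalRestrictField
import Literature.NumberTheory.GaloisRepresentations.LocalGaloisGroupInertiaProofs
import Literature.NumberTheory.GaloisRepresentations.TateTwistFrobeniusProofs
import Literature.NumberTheory.GaloisRepresentations.RestrictFieldSemisimpleFiniteProofs
import Literature.NumberTheory.GaloisRepresentations.AbsIrreducibleIndexTwo
import Literature.NumberTheory.GaloisRepresentations.FramedRepBlockSum
import Literature.NumberTheory.GaloisRepresentations.ResidualRepRestrict
import Literature.NumberTheory.PAdicHodge.LocallyCyclotomicCharacterDeRham
import Literature.RepresentationTheory.Semisimple.Semisimplification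
import Literature.RepresentationTheory.Semisimple.Twist
import Mathlib.NumberTheory.NumberField.CMField
import Literature.NumberTheory.Automorphic.AutomorphicInductionDescentLemmas
import HarnessLib

/-!
# Stub `stub_automorphicTwistOfInducedAutomorphy` (crux stmt-Langlands-17000, line `symmetrise-pd-split`,
# stub 3') — the Arthur–Clozel descent of the automorphy of `Ind_E^K(ρ|_E ⊗ χ)|Γ_{K'}` to `ρ|_{EK'} ⊗ χ''`

Wave-2 stub-worker proof (prover-line-stmt-Langlands-17000-0, 2026-08-17) of stub 3' — registered in
skeleton v7 (`Cruxes/TwistedInductionParallel/Lines/symmetrise_pd_split.lean`) in the corrected shape below,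
and landed here as `stub_automorphicTwistOfInducedAutomorphy` (arrow-form wrapper, end of §9).  The v4
signature `theoremA_existence → … → InducedTwistAutomorphic F p ρ → AutomorphicTwistOverCMHT F p ρ`
is not derivable as typed, for two separable reasons, and IS derivable (this file, rc 0, no `sorry`,
standard axioms) in the corrected shape `automorphicTwistOfInducedAutomorphy_of_facts` below:

1. THREE NAMED FACTS are consumed besides HLTT Thm. A: Arthur–Clozel Ch. 3 Thm. 4.2 (b) in the Borel–Jacquet
   datum model (`ArthurClozel1989_automorphicInduction_of_selfTwist`, LANDED p170113 as
   `Literature/NumberTheory/Automorphic/AutomorphicInductionOfSelfTwist.lean`; the tree had (b) only in the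
   `L²_cusp` model), Henniart's archimedean theorem for automorphic
   induction (`Henniart2012_infinityType_of_automorphicInduction`, tree) and the existence of infinity types
   (`AutomorphicRepData.exists_hasInfinityType`, tree; Clozel 1990 §3.3) — the last two give the regular
   algebraicity of the descended `Π₁`, without which HLTT Thm. A does not apply to it.
2. ONE EXTRA WAYPOINT CLAUSE: `I|Γ_{K'}` irreducible (`InducedTwistAutomorphicIrr`, §9).  Without it
   `W|Γ_{EK'}` (`W = ρ|_E ⊗ χ`) may be reducible (if `K'` meets the dihedral field of `ρ̄`), and then the
   cuspidal `GL₂`-constituents `Π₁, Π₁^σ` of the base change need not match `W|Γ_{EK'}` (cross-matching of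
   characters), so the registered conclusion (automorphy through a CUSPIDAL `π₂`) is out of reach.  In print
   the clause comes from the avoid-field of BLGGT Thm. 4.5.1, dropped by the landed Thm. C.

Contents: §6 local algebraicity above `p` under restriction / cyclotomic twist, and the Hodge–Tate bridge
(landed p167630); §9 the descent.  The route-independent bookkeeping (§3 the self-twist `I ⊗ η_{E/K} ≅ I`
read on Satake parameters at the inert places; §8 regular algebraicity of `Π₁` (Henniart) and the Frobenius
polynomials of `(r(Π₁) ⊕ r(Π₁^σ)) ⊗ ε⁻¹` against `I|Γ_{E'}`) is LANDED as
`Literature/NumberTheory/Automorphic/AutomorphicInductionDescentLemmas.lean` (400-line cap).  The Galois /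
linear-algebra glue (compositum `E' = EK'` as a type, quadratic sign character, the diamond
`Γ_{E'} = Γ_E ∩ Γ_{K'}`, the index-two bound, Schur block matching, `(Ind W)|Γ_E|Γ_{E'}` as a block sum)
is LANDED as `Literature/NumberTheory/GaloisRepresentations/InducedRestrictCompositumBlocks.lean` (p170083).
Census: `work/stubs/StubAutomorphicTwistOfInducedAutomorphy-census.md`.
-/

noncomputable section

open scoped NumberField MatrixGroups Matrix Polynomial IntermediateField Classical
open NumberField IsDedekindDomain Field Filter Polynomial
open Literature.NumberTheory.GaloisRepresentations Literature.NumberTheory.PAdicHodge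
open Literature.NumberTheory.Automorphic

-- `Summit.Langlands.Langlands.…` repeats a namespace component by design (D-0017 nested layout).
set_option linter.dupNamespace false

namespace Summit.Langlands.Langlands.Cruxes.TwistedInductionParallel.SymmetrisePdSplit

/-! ## 6. Local algebraicity above `p` is stable under restriction and under the cyclotomic twist -/

section LocalAlgebraic

variable {p : ℕ} [Fact p.Prime] {E E' : Type} [Field E] [NumberField E] [Field E'] [NumberField E']
  [Algebra E E']

/-- **Restriction of a locally algebraic character is locally algebraic** (same exponent): for
`u' ∣ u ∣ p`, the two routes `Γ_{E'_{u'}} → Γ_E` are conjugate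
(`exists_absGaloisRestrict_adicCompletion_eq_conj`, invisible to a character), the local restriction
maps inertia into inertia (`absInertia_map_absGaloisRestrict_le_holds`), and the cyclotomic character is
compatible with restriction (`cyclotomicCharacter_absGaloisRestrict`). [folklore] -/
theorem isLocallyAlgebraicAbove_comp_absGaloisRestrict {χ : absoluteGaloisGroup E →ₜ* (PadicAlgCl p)ˣ}
    (h : IsLocallyAlgebraicAbove p E χ) :
    IsLocallyAlgebraicAbove p E' (χ.comp (absGaloisRestrict E E')) := by
  intro u' hu'
  set u : HeightOneSpectrum (𝓞 E) := u'.under (𝓞 E) with hudef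
  haveI : u'.asIdeal.LiesOver u.asIdeal := liesOver_under u'
  have hu : ((p : ℕ) : 𝓞 E) ∈ u.asIdeal := (natCast_mem_asIdeal_iff_of_liesOver u u' p).mp hu'
  obtain ⟨k, hk⟩ := h u hu
  refine ⟨k, fun σ hσ => ?_⟩
  letI := (adicCompletionOfLiesOver E E' u u').toAlgebra
  obtain ⟨τ, hτ⟩ := exists_absGaloisRestrict_adicCompletion_eq_conj (F := E) (E := E') u u'
  have hI : absGaloisRestrict (u.adicCompletion E) (u'.adicCompletion E') σ ∈ absInertia (u.adicCompletion E) :=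
    absInertia_map_absGaloisRestrict_le_holds (u.adicCompletion E) (u'.adicCompletion E') ⟨σ, hσ, rfl⟩
  haveI := LocalField.charZero_adicCompletion u
  haveI : NeZero ((p : ℕ) : u.adicCompletion E) := ⟨Nat.cast_ne_zero.mpr (Fact.out : p.Prime).ne_zero⟩
  change ((χ (absGaloisRestrict E E' (absGaloisRestrict E' (u'.adicCompletion E') σ)) : (PadicAlgCl p)ˣ) :
    PadicAlgCl p) = _
  rw [hτ, map_mul, map_mul, map_inv, mul_inv_cancel_comm, hk _ hI,
    cyclotomicCharacter_absGaloisRestrict]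

/-- **Twisting by a power of the cyclotomic character shifts the local exponents.** [folklore] -/
theorem isLocallyAlgebraicAbove_mul_of_cyclotomic_zpow {χ ε : absoluteGaloisGroup E →ₜ* (PadicAlgCl p)ˣ}
    (h : IsLocallyAlgebraicAbove p E χ) {t : ℤ}
    (hε : ∀ σ, (ε σ : PadicAlgCl p) =
      (algebraMap ℚ_[p] (PadicAlgCl p) ((GaloisRep.cyclotomicCharacter E p σ : ℤ_[p]ˣ) : ℤ_[p])) ^ t) :
    IsLocallyAlgebraicAbove p E (ε * χ) := by
  intro u hu
  obtain ⟨k, hk⟩ := h u hu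
  refine ⟨t + k, fun σ hσ => ?_⟩
  haveI := LocalField.charZero_adicCompletion u
  haveI : NeZero ((p : ℕ) : u.adicCompletion E) := ⟨Nat.cast_ne_zero.mpr (Fact.out : p.Prime).ne_zero⟩
  have hne : (algebraMap ℚ_[p] (PadicAlgCl p)
      ((GaloisRep.cyclotomicCharacter (u.adicCompletion E) p σ : ℤ_[p]ˣ) : ℤ_[p])) ≠ 0 := by
    rw [map_ne_zero_iff _ (algebraMap ℚ_[p] (PadicAlgCl p)).injective, Ne, PadicInt.coe_eq_zero]
    exact Units.ne_zero _
  rw [ContinuousMonoidHom.mul_apply, Units.val_mul, hk σ hσ, hε, cyclotomicCharacter_absGaloisRestrict,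
    ← zpow_add₀ hne]

/-- **Locally algebraic ⇒ Hodge–Tate-algebraic, unconditionally** (the two landed lemmas of
`PAdicHodge/LocallyCyclotomicCharacterDeRham`, p167630: an unramified twist of `ε^k` is de Rham for
THE pinned datum and has one labelled weight at every `ℚ_p`-label). [cite: FontaineAsterisque223III, Exp. III Prop. 1.5.2]
[cite: Patrikis2019, §2.7.1] -/
theorem isHodgeTateAlgebraicAbove_of_isLocallyAlgebraicAbove' {χ : absoluteGaloisGroup E →ₜ* (PadicAlgCl p)ˣ}
    (h : IsLocallyAlgebraicAbove p E χ) : IsHodgeTateAlgebraicAbove p E χ := fun u hu => by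
  obtain ⟨k, hk⟩ := h u hu
  exact ⟨isDeRhamFramed_toLocal_scalar_comp_of_inertia_eq_cyclotomic_zpow χ u hu k hk,
    exists_labelledHodgeTateWeightsAt_eq_singleton_of_inertia_eq_cyclotomic_zpow χ u hu k hk⟩

end LocalAlgebraic

/-! ## 9. The descent: the stub with its named facts as leading hypotheses, for the waypoint carrying
the irreducibility of `I|Γ_{K'}` -/

section Main

-- (`InducedTwistAutomorphicIrr` is the v7 waypoint of the imported Defs file `…SymmetriseDefsV7`, p170396.)

/-- The framed twist has underlying representation the twist (bridge to `Representation.twist`). [folklore] -/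
private theorem toRepresentation_twist {G : Type*} [Group G] [TopologicalSpace G] {k : Type*} [Field k]
    [TopologicalSpace k] [IsTopologicalRing k] {n : ℕ} (ρ : FramedRep G k n) (χ : G →ₜ* kˣ) :
    FramedRep.toRepresentation (FramedRep.twist ρ χ) =
      Literature.RepresentationTheory.Semisimple.Representation.twist (FramedRep.toRepresentation ρ)
        χ.toMonoidHom := by
  refine MonoidHom.ext fun g => LinearMap.ext fun v => ?_
  change ((FramedRep.twist ρ χ g : GL (Fin n) k) : Matrix (Fin n) (Fin n) k) *ᵥ v =
    ((χ.toMonoidHom g : kˣ) : k) • (((ρ g : GL (Fin n) k) : Matrix (Fin n) (Fin n) k) *ᵥ v)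
  rw [FramedRep.coe_twist_apply, Matrix.smul_mulVec]
  rfl

/-- **STUB 3' (corrected shape): the Arthur–Clozel descent.**  Granted (1) the existence half of HLTT's
Thm. A, (2) Arthur–Clozel Ch. 3 Thm. 4.2 (b) in the datum model
(`ArthurClozel1989_automorphicInduction_of_selfTwist`), (3) Henniart's archimedean theorem for automorphic
induction and (4) the existence of infinity types (Clozel 1990 §3.3): for `F` imaginary quadratic,
`ρ : Γ_F → GL₂(ℚ̄_p)` irreducible, and the waypoint `InducedTwistAutomorphicIrr F p ρ` (automorphy of
`I|Γ_{K'}`, `I = Ind_E^K(ρ|_E ⊗ χ)`, over a totally real Galois `K'/K`, WITH `I|Γ_{K'}` irreducible), the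
twist `ρ|_{E'} ⊗ χ''` over the CM field `E' = E K'` is automorphic in Qian's sense, with
`χ'' = χ|_{Γ_{E'}} · ε_p` Hodge–Tate-algebraic above `p`.  Proof: §§1–8 of this file (compositum; self-twist
`I ⊗ η_{E/K} ≅ I` read on Satake parameters at the inert places; (b) gives cuspidal `Π₁, Π₁^σ` on
`GL₂(𝔸_{E'})` with `Π` automorphically induced from them, regular algebraic by Henniart; HLTT attaches
`r₁, r₂`; `(r₁ ⊕ r₂) ⊗ ε⁻¹` and `I|Γ_{E'}` have the same Frobenius polynomials almost everywhere, hence are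
isomorphic (Chebotarev, Brauer–Nesbitt); `I|Γ_{E'} = W|Γ_{E'} ⊕ W^σ|Γ_{E'}` with irreducible blocks (index
two), and Schur's lemma matches `W|Γ_{E'} ⊗ ε` with `r₁` or `r₂`).
[cite: ArthurClozelAMS120, Ch. 3 Thm. 4.2 (b)] [cite: HarrisLanTaylorThorneRMS2016, Thm. A] -/
theorem automorphicTwistOfInducedAutomorphy_of_facts
    (hA : HarrisLanTaylorThorne2016.theoremA_existence)
    (hAC : ArthurClozel1989_automorphicInduction_of_selfTwist)
    (hH : Henniart2012_infinityType_of_automorphicInduction)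
    (hex : ∀ (E : Type) [Field E] [NumberField E] (N : ℕ) (hcpt : isCompact_glFiniteIntegralLevel N E)
      (P : CuspidalAutomorphicRepData N E hcpt), P.1.exists_hasInfinityType)
    (F : Type) [Field F] [NumberField F] [Algebra.IsQuadraticExtension ℚ F]
    (_hF : NumberField.IsTotallyComplex F) (p : ℕ) [Fact p.Prime]
    (ρ : FramedGaloisRep F (PadicAlgCl p) 2) (hρ : ρ.toGaloisRep.IsIrreducible)
    (_hunr : ∀ᶠ v : IsDedekindDomain.HeightOneSpectrum (NumberField.RingOfIntegers F) in Filter.cofinite,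
      ρ.IsUnramifiedAt v)
    (_hgood : GoodRegime F p ρ) (hI : InducedTwistAutomorphicIrr F p ρ) :
    AutomorphicTwistOverCMHT F p ρ := by
  obtain ⟨K, E, _, _, _, _, _, _, hd, hK, hEcm, χ, θ, hχ, -, -, -, K', _, _, _, hGal, hK', ι, hss, hirr,
    hcpt, π₄, hRA, hC⟩ := hI
  haveI := hGal
  haveI : FiniteDimensional K E := Module.finite_of_finrank_eq_succ hd
  haveI : Algebra.IsQuadraticExtension K E := ⟨hd⟩
  haveI : IsGalois K E := inferInstance
  haveI : IsTotallyComplex E := hEcm.to_isTotallyComplex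
  haveI : IsTotallyReal K' := hK'
  -- §1 the compositum `E' = E K'`, a CM field
  obtain ⟨E', _, _, _, _, _, _, _, h2, htc, hcomp⟩ := exists_quadratic_compositum K E K' hd inferInstance hK'
  haveI : FiniteDimensional K' E' := Module.finite_of_finrank_eq_succ h2
  haveI : Algebra.IsQuadraticExtension K' E' := ⟨h2⟩
  haveI : IsGalois K' E' := inferInstance
  haveI : IsTotallyComplex E' := htc
  have hE'cm : IsCMField E' := IsCMField.ofCMExtension K' E'
  letI : Algebra F E' := ((algebraMap E E').comp (algebraMap F E)).toAlgebra
  haveI : IsScalarTower F E E' := IsScalarTower.of_algebraMap_eq fun _ => rfl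
  have hcyc : IsCyclic (E' ≃ₐ[K'] E') :=
    isCyclic_of_prime_card (p := Module.finrank K' E') (hp := ⟨by rw [h2]; exact Nat.prime_two⟩)
      (IsGalois.card_aut_eq_finrank K' E')
  obtain ⟨σ₀, hσ₀⟩ : ∃ σ₀ : E' ≃ₐ[K'] E', σ₀ ≠ 1 := by
    have hcard : 1 < Fintype.card (E' ≃ₐ[K'] E') := by
      rw [← Nat.card_eq_fintype_card, IsGalois.card_aut_eq_finrank, h2]; exact one_lt_two
    obtain ⟨σ₀, hσ₀⟩ := Fintype.exists_ne_of_one_lt_card hcard 1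
    exact ⟨σ₀, hσ₀⟩
  -- notation
  set W : FramedGaloisRep E (PadicAlgCl p) 2 := FramedRep.twist (ρ.restrictField E) χ with hWdef
  set I : FramedGaloisRep K (PadicAlgCl p) (2 * 2) := W.induce K hd with hIdef
  -- §3 the self-twist on Satake parameters, §7 Arthur–Clozel (b)
  have hST := eventually_satake_map_neg_eq hd h2 hcomp W ι π₄.1 hC
  have hE' : isCompact_glFiniteIntegralLevel 2 E' := isCompact_glFiniteIntegralLevel_holds 2 E'
  obtain ⟨Pf, hconj, hAI⟩ := hAC K' E' (2 * 2) 2 (by rw [h2]; exact Nat.prime_two) two_pos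
    (by rw [h2]) hcpt hE' π₄ hST
  -- §8 regular algebraicity, HLTT
  have hRAτ : ∀ τ, (Pf τ).1.IsRegularAlgebraic := fun τ =>
    isRegularAlgebraic_of_isAutomorphicInductionAlong_two_two hH hcyc h2 π₄ (Pf τ) (hAI τ) hRA
      (hex E' 2 hE' (Pf τ))
  have hr : ∀ τ, ∃ r : FramedGaloisRep E' (PadicAlgCl p) 2, r.toGaloisRep.IsSemisimple ∧
      HarrisLanTaylorThorne2016.IsCompatible (Pf τ).1 ι r := fun τ =>
    hA hE' (Or.inr hE'cm) (Pf τ) (hRAτ τ) p ι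
  choose r hrss hrc using hr
  -- the Tate twist
  obtain ⟨ε', hε'⟩ := exists_cyclotomicCharacter_padicAlgCl_zpow E' p (-1)
  set T : FramedGaloisRep E' (PadicAlgCl p) (2 + 2) :=
    FramedRep.blockSum ((r 1).twist ε') ((r σ₀).twist ε') with hTdef
  -- §8 Frobenius match, then Chebotarev–Brauer–Nesbitt
  have hev := eventually_frobenius_match h2 hσ₀ ι π₄.1 (I.restrictField K') hC Pf (hconj σ₀) (hAI 1)
    r hrc hε'
  have hRss : ((I.restrictField K').restrictField E').toGaloisRep.IsSemisimple :=
    FramedGaloisRep.isSemisimple_restrictField_of_finiteDimensional (M := E') (I.restrictField K') hss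
  have htwss : ∀ τ, (FramedGaloisRep.toGaloisRep (FramedRep.twist (r τ) ε')).IsSemisimple := fun τ => by
    change (FramedRep.toRepresentation (FramedRep.twist (r τ) ε')).IsSemisimpleRepresentation
    rw [toRepresentation_twist]
    exact (Literature.RepresentationTheory.Semisimple.Representation.isSemisimpleRepresentation_twist_iff
      _ _).mpr (hrss τ)
  have hTss : T.toGaloisRep.IsSemisimple :=
    Literature.RepresentationTheory.Semisimple.isSemisimpleRepresentation_of_blockDiag finSumFinEquiv
      (A := ((r 1).twist ε').toMonoidHom) (D := ((r σ₀).twist ε').toMonoidHom)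
      (ψ := T.toMonoidHom) (fun _ => rfl) (htwss 1) (htwss σ₀)
  obtain ⟨e⟩ := FramedGaloisRep.nonempty_equiv_of_hasFrobCharpolyAt_eventually chebotarev_artinRep_holds
    ((I.restrictField K').restrictField E') T hRss hTss hev
  -- §5 `T = S ((I|E)|E') S⁻¹ = S (B₀ ⊞ B₁) S⁻¹`
  obtain ⟨e1⟩ := SorensenPatching.nonempty_equiv_restrictField_restrictField K K' E' I
  obtain ⟨e2⟩ := SorensenPatching.nonempty_equiv_restrictField_restrictField K E E' I
  obtain ⟨S, hS⟩ := FramedRep.exists_eq_conj_of_equiv ((I.restrictField E).restrictField E') T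
    (e2.symm.trans (e1.trans e))
  obtain ⟨P, hP⟩ := FramedRep.exists_eq_conj_of_equiv ((I.restrictField E).restrictField E')
    ((I.restrictField K').restrictField E') (e2.symm.trans e1)
  rw [hIdef, induce_restrictField_restrictField_eq_blockSum hd W] at hS hP
  set B : Fin 2 → FramedGaloisRep E' (PadicAlgCl p) 2 := fun i =>
    (W.outerConj (absGaloisCosetRep K E hd i)⁻¹).restrictField E' with hBdef
  -- §4 the blocks are irreducible (index two)
  have hindex : ((absGaloisRestrict K' E' : absoluteGaloisGroup E' →* absoluteGaloisGroup K').range).index = 2 :=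
    (isOpen_range_absGaloisRestrict_and_index_eq_two K' E' h2).2
  have hBirr : ∀ i : Fin 2, FramedRep.IsIrreducible (B i) := by
    intro i
    by_contra hred
    obtain ⟨W₀, hW₀b, hW₀t⟩ := exists_subrepresentation_of_not_isIrreducible two_pos hred
    -- `dim W₀ = 1`
    have hfr : Module.finrank (PadicAlgCl p) W₀.toSubmodule = 1 := by
      have hlt : Module.finrank (PadicAlgCl p) W₀.toSubmodule < 2 := by
        have h := Submodule.finrank_lt (s := W₀.toSubmodule)
          (fun h => hW₀t (Subrepresentation.toSubmodule_injective h))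
        simpa using h
      have hpos : 0 < Module.finrank (PadicAlgCl p) W₀.toSubmodule :=
        Nat.pos_of_ne_zero fun h0 =>
          hW₀b (Subrepresentation.toSubmodule_injective (Submodule.finrank_eq_zero.mp h0))
      omega
    -- transport to `B 0 ⊞ B 1`, then to `(I|K')|E' = P (B 0 ⊞ B 1) P⁻¹`
    obtain ⟨W₁, hW₁⟩ : ∃ W₁ : Subrepresentation (FramedRep.blockSum (B 0) (B 1)).toRepresentation,
        Module.finrank (PadicAlgCl p) W₁.toSubmodule = 1 := by
      fin_cases i
      · obtain ⟨W₁, hW₁⟩ := exists_subrepresentation_blockSum_left (B 0) (B 1) W₀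
        exact ⟨W₁, hW₁.trans hfr⟩
      · obtain ⟨W₁, hW₁⟩ := exists_subrepresentation_blockSum_right (B 0) (B 1) W₀
        exact ⟨W₁, hW₁.trans hfr⟩
    obtain ⟨W₂, hW₂⟩ := exists_subrepresentation_conj _ P W₁
    have hW₂ne : W₂ ≠ ⊥ := by
      intro h
      rw [h, hW₁, show (⊥ : Subrepresentation (FramedRep.conj P (FramedRep.blockSum (B 0) (B 1))).toRepresentation).toSubmodule
        = ⊥ from rfl, finrank_bot] at hW₂
      exact zero_ne_one hW₂
    have hle := finrank_le_two_mul_of_index_two (I.restrictField K').toRepresentation hirr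
      (absGaloisRestrict K' E' : absoluteGaloisGroup E' →* absoluteGaloisGroup K') hindex
      (π' := (FramedRep.conj P (FramedRep.blockSum (B 0) (B 1))).toRepresentation)
      (fun h => by rw [← hP]; rfl) W₂ hW₂ne
    rw [hW₂, hW₁] at hle
    norm_num at hle
  -- the block in `res(Γ_E)` is a change of frame of `U = W|Γ_{E'}`
  obtain ⟨i₀, τ₀, hτ₀⟩ := exists_absGaloisCosetRep_mem_range (K := K) (E := E) hd
  set U : FramedGaloisRep E' (PadicAlgCl p) 2 := W.restrictField E' with hUdef
  have hBi₀ : B i₀ = FramedRep.conj (W τ₀⁻¹) U := by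
    simp only [hBdef, hUdef]
    rw [← hτ₀]
    exact outerConj_inv_restrictField_eq_conj W τ₀
  -- §4 Schur matching: some `r k ⊗ ε'` is a conjugate of `B i₀`
  have hmatch : ∃ (k : E' ≃ₐ[K'] E') (X : GL (Fin 2) (PadicAlgCl p)),
      FramedRep.twist (r k) ε' = FramedRep.conj X (B i₀) := by
    fin_cases i₀
    · rcases exists_eq_conj_of_blockSum_eq_conj_blockSum two_pos (B 0) (B 1) ((r 1).twist ε')
        ((r σ₀).twist ε') S hS (hBirr 0) with ⟨X, hX⟩ | ⟨X, hX⟩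
      · exact ⟨1, X, hX⟩
      · exact ⟨σ₀, X, hX⟩
    · rcases exists_eq_conj_of_blockSum_eq_conj_blockSum' two_pos (B 0) (B 1) ((r 1).twist ε')
        ((r σ₀).twist ε') S hS (hBirr 1) with ⟨X, hX⟩ | ⟨X, hX⟩
      · exact ⟨1, X, hX⟩
      · exact ⟨σ₀, X, hX⟩
  obtain ⟨k, X, hX⟩ := hmatch
  rw [hBi₀, ← FramedRep.conj_mul_eq_conj_conj] at hX
  -- `U = d (ρ|E' ⊗ χ') d⁻¹`
  set χ' : absoluteGaloisGroup E' →ₜ* (PadicAlgCl p)ˣ := χ.comp (absGaloisRestrict E E') with hχ'def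
  obtain ⟨e3⟩ := SorensenPatching.nonempty_equiv_restrictField_restrictField F E E' ρ
  obtain ⟨d, hdconj⟩ := FramedRep.exists_eq_conj_of_equiv (ρ.restrictField E')
    ((ρ.restrictField E).restrictField E') e3
  have hU : U = FramedRep.conj d (FramedRep.twist (ρ.restrictField E') χ') := by
    simp only [hUdef, hWdef]
    change FramedRep.twist ((ρ.restrictField E).restrictField E') χ' = _
    rw [hdconj, FramedRep.conj_twist]
  rw [hU, ← FramedRep.conj_mul_eq_conj_conj] at hX
  -- untwist: `r k = Y (ρ|E' ⊗ χ'') Y⁻¹`, `χ'' = ε'⁻¹ χ'`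
  have hrk : r k = FramedRep.conj (X * W τ₀⁻¹ * d) (FramedRep.twist (ρ.restrictField E') (ε'⁻¹ * χ')) := by
    rw [FramedRep.conj_twist, ← FramedRep.twist_twist_inv (r k) ε', hX, FramedRep.conj_twist,
      FramedRep.twist_twist]
  have hfin : FramedRep.twist (ρ.restrictField E') (ε'⁻¹ * χ') =
      FramedRep.conj (X * W τ₀⁻¹ * d)⁻¹ (r k) := by
    rw [hrk, FramedRep.conj_inv_conj_eq]
  -- conclusion
  refine ⟨E', inferInstance, inferInstance, inferInstance, hE'cm, ε'⁻¹ * χ', ι, ?_, ?_⟩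
  · -- Hodge–Tate algebraicity of `χ'' = ε_p · χ|Γ_{E'}`
    apply isHodgeTateAlgebraicAbove_of_isLocallyAlgebraicAbove'
    refine isLocallyAlgebraicAbove_mul_of_cyclotomic_zpow (t := 1)
      (isLocallyAlgebraicAbove_comp_absGaloisRestrict hχ) fun σ => ?_
    change (((ε' σ)⁻¹ : (PadicAlgCl p)ˣ) : PadicAlgCl p) = _
    rw [Units.val_inv_eq_inv_val, hε', zpow_neg_one, inv_inv, zpow_one]
  · -- Qian automorphy through `Π k`
    refine Qian2022.IsAutomorphic.of_hltt ?_ hE' (Pf k) (hRAτ k) ?_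
    · have hρss : ρ.toGaloisRep.IsSemisimple := by
        haveI : IsSimpleOrder (Subrepresentation ρ.toRepresentation) := hρ
        exact (inferInstance : ComplementedLattice (Subrepresentation (FramedRep.toRepresentation ρ)))
      have h1 := FramedGaloisRep.isSemisimple_restrictField_of_finiteDimensional (M := E') ρ hρss
      change (FramedRep.toRepresentation (FramedRep.twist (ρ.restrictField E') (ε'⁻¹ * χ'))).IsSemisimpleRepresentation
      rw [toRepresentation_twist]
      exact (Literature.RepresentationTheory.Semisimple.Representation.isSemisimpleRepresentation_twist_iff
        _ _).mpr h1
    · rw [hfin, HarrisLanTaylorThorne2016.isCompatible_conj_iff]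
      exact hrc k

/-- **STUB 3' of skeleton v7 (registered signature, arrow form)** — the corrected shape, proved by
`automorphicTwistOfInducedAutomorphy_of_facts`. [cite: ArthurClozelAMS120, Ch. 3 Thm. 4.2 (b)]
[cite: HarrisLanTaylorThorneRMS2016, Thm. A] -/
theorem stub_automorphicTwistOfInducedAutomorphy :
    HarrisLanTaylorThorne2016.theoremA_existence →
    Literature.NumberTheory.Automorphic.ArthurClozel1989_automorphicInduction_of_selfTwist →
    Henniart2012_infinityType_of_automorphicInduction →
    (∀ (E : Type) [Field E] [NumberField E] (N : ℕ) (hcpt : isCompact_glFiniteIntegralLevel N E)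
      (P : CuspidalAutomorphicRepData N E hcpt), P.1.exists_hasInfinityType) →
    ∀ (F : Type) [Field F] [NumberField F] [Algebra.IsQuadraticExtension ℚ F],
    NumberField.IsTotallyComplex F → ∀ (p : ℕ) [Fact p.Prime]
    (ρ : FramedGaloisRep F (PadicAlgCl p) 2),
    ρ.toGaloisRep.IsIrreducible →
    (∀ᶠ v : IsDedekindDomain.HeightOneSpectrum (NumberField.RingOfIntegers F) in Filter.cofinite,
      ρ.IsUnramifiedAt v) →
    GoodRegime F p ρ → InducedTwistAutomorphicIrr F p ρ → AutomorphicTwistOverCMHT F p ρ :=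
  fun hA hAC hH hex F _ _ _ hF p _ ρ hρ hunr hgood hI =>
    automorphicTwistOfInducedAutomorphy_of_facts hA hAC hH hex F hF p ρ hρ hunr hgood hI

end Main


end Summit.Langlands.Langlands.Cruxes.TwistedInductionParallel.SymmetrisePdSplit

end
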